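import Literature.AlgebraicGeometry.Frobenioids.RlfPrimesWeak
import Literature.AlgebraicGeometry.Frobenioids.PerfectionDivisorial
import HarnessLib

/-!
# Frobenioids I, Def. 2.4 (i) / Prop. 5.3 — homomorphisms `M^rlf → N^rlf` over `f^pf`, ONE PRIME AT A TIME,
# in the WEAK vocabulary (`IsPerfFactorialWeak`)

Mochizuki, *The geometry of Frobenioids I*, Kyushu J. Math. **62** (2008), Def. 2.4 (i) p. 48 (the
realification `M^rlf ⊆ ∏_𝔮 M^rlf_𝔮`), Prop. 5.3 p. 103 l. 12 ("the divisor monoid `Φ^rlf`")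
[cite: MochizukiFrdI2008, Def. 2.4(i) p.48] [cite: MochizukiFrdI2008, Prop. 5.3 p.103].

Weak-vocabulary twin (cell abc-iut, seat abc-iut-w5-d153 gen 4) of the one-prime part of
`RealificationMapInjectiveFiniteSupp.lean` (seat abc-iut-w4-d084): every hypothesis `IsPerfFactorial` is replaced by
`IsPerfFactorialWeak` (condition (d) of Def. 2.4 (i) replaced by (d_ord)/(d_res), `PerfFactorialWeak.lean` — the
vocabulary of record for the divisor monoids of [EtTh] §3, F-L2d2-1), and the realified map `f^rlf` by ANY homomorphism
`φ : M^rlf → N^rlf` lying over `f^pf` (`hφ : φ (ι_M a) = ι_N (f^pf a)`; e.g. the weak realification functor's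
`rlfMapWeak`, characterised by `rlfMapWeak_comp_toRealification`):
* bookkeeping on restrictions `x|_𝔭` (`exists_eq_restrict_mul`, `restrict_eq_of_eq_restrict_mul`, …);
* `dvd_total_of_supp_subset_singleton` (one prime is totally ordered), `supp_toRealification_of_mem_carrier`
  (`Supp(ι p) = {𝔭}` for a primary `p ∈ 𝔭`), `supp_apply_restrict_subset` (`Supp(φ(x|_𝔭)) ⊆ Supp(ι_N f^pf p)`),
  `eq_one_of_apply_eq_one_of_supp_subset` (`φ` kills no single-prime element when `f` is injective),
  `restrict_eq_of_apply_restrict_eq`.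
Sequel: `RealificationMapInjectiveCountableSuppWeak.lean` (prime-by-prime on countable supports, injectivity).
Proof-only (no definitions).  Nothing here bears on [IUTchIII] Cor. 3.12 (L1 = [FrdI], refereed).
-/

noncomputable section

namespace Literature.AlgebraicGeometry.Frobenioids

open Function
open IsPerfFactorial (single' single'_apply_same single'_apply_of_ne single'_one)

universe w

namespace IsPerfFactorialWeak

namespace Rlf

variable {M : Type w} [CommMonoid M] {N : Type w} [CommMonoid N]

/-! ### Restrictions to one prime: bookkeeping -/

/-- The underlying factorization of `ι(a) ∈ M^rlf` (`a ∈ M^pf`) is `factorMap a`. [cite: MochizukiFrdI2008, Def. 2.4(i) p.48] -/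
theorem coe_toRealification (hM : IsPerfFactorialWeak M) (a : Perfection M) : (hM.toRealification a : RlfFactor M) = factorMap M a := rfl

/-- Any element of `M^rlf_factor` supported inside `Supp(x)`, `x ∈ M^rlf`, lies in `M^rlf`.
[cite: MochizukiFrdI2008, Def. 2.4(i) p.48] -/
theorem mem_realification_of_supp_subset (hM : IsPerfFactorialWeak M) {v : RlfFactor M} (x : hM.Rlf)
    (hv : supp v ⊆ supp (x : RlfFactor M)) : v ∈ hM.realification := by
  obtain ⟨b, hb⟩ := x.2
  exact ⟨b, hv.trans hb⟩

/-- Splitting off one prime: every `x ∈ M^rlf` is `x|_𝔭 · x'` with `x'` trivial at `𝔭` and supported inside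
`Supp(x)`. [cite: MochizukiFrdI2008, Def. 2.4(i) p.48] -/
theorem exists_eq_restrict_mul (hM : IsPerfFactorialWeak M) (x : hM.Rlf) (𝔭 : Primes (Perfection M)) :
    ∃ x' : hM.Rlf, x = hM.restrict 𝔭 x * x' ∧ (x' : RlfFactor M) 𝔭 = 1 ∧
      supp (x' : RlfFactor M) ⊆ supp (x : RlfFactor M) := by
  classical
  let x'v : RlfFactor M := Function.update (x : RlfFactor M) 𝔭 1
  have hsupp : supp x'v ⊆ supp (x : RlfFactor M) := by
    intro 𝔮 h𝔮
    by_cases h : 𝔮 = 𝔭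
    · subst h
      exact (h𝔮 (Function.update_self _ _ _)).elim
    · have : x'v 𝔮 = (x : RlfFactor M) 𝔮 := Function.update_of_ne h _ _
      intro h1
      exact h𝔮 (this.trans h1)
  have hx'𝔭 : x'v 𝔭 = 1 := Function.update_self _ _ _
  refine ⟨⟨x'v, mem_realification_of_supp_subset hM x hsupp⟩, ?_, hx'𝔭, hsupp⟩
  apply Subtype.ext
  funext 𝔮
  rw [coe_mul, Pi.mul_apply, coe_restrict]
  by_cases h : 𝔮 = 𝔭
  · subst h
    rw [single'_apply_same]
    show _ = _ * x'v 𝔮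
    rw [hx'𝔭, mul_one]
  · rw [single'_apply_of_ne h, one_mul]
    show _ = x'v 𝔮
    exact (Function.update_of_ne h _ _).symm

/-- The `𝔭`-component of `x|_𝔭` is that of `x`. [cite: MochizukiFrdI2008, Def. 2.4(i) p.48] -/
theorem apply_restrict_same (hM : IsPerfFactorialWeak M) (𝔭 : Primes (Perfection M)) (x : hM.Rlf) :
    (hM.restrict 𝔭 x : RlfFactor M) 𝔭 = (x : RlfFactor M) 𝔭 := by
  rw [coe_restrict, single'_apply_same]

/-- `x|_𝔭` only depends on the `𝔭`-component of `x`. [cite: MochizukiFrdI2008, Def. 2.4(i) p.48] -/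
theorem restrict_eq_restrict_of_apply_eq (hM : IsPerfFactorialWeak M) {𝔭 : Primes (Perfection M)} {x y : hM.Rlf}
    (h : (x : RlfFactor M) 𝔭 = (y : RlfFactor M) 𝔭) : hM.restrict 𝔭 x = hM.restrict 𝔭 y :=
  Subtype.ext (by rw [coe_restrict, coe_restrict, h])

/-- `x|_𝔭 = 1` when the `𝔭`-component of `x` is trivial. [cite: MochizukiFrdI2008, Def. 2.4(i) p.48] -/
theorem restrict_eq_one_of_apply_eq_one (hM : IsPerfFactorialWeak M) {𝔭 : Primes (Perfection M)} {x : hM.Rlf}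
    (h : (x : RlfFactor M) 𝔭 = 1) : hM.restrict 𝔭 x = 1 :=
  Subtype.ext (by rw [coe_restrict, h, single'_one, coe_one])

/-- Two elements of `M^rlf` with the same restrictions to every prime are equal.
[cite: MochizukiFrdI2008, Def. 2.4(i) p.48] -/
theorem eq_of_forall_restrict_eq (hM : IsPerfFactorialWeak M) {x y : hM.Rlf} (h : ∀ 𝔭, hM.restrict 𝔭 x = hM.restrict 𝔭 y) : x = y := by
  apply Subtype.ext
  funext 𝔭
  rw [← apply_restrict_same hM 𝔭 x, ← apply_restrict_same hM 𝔭 y, h 𝔭]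

/-- In a splitting `x = x|_𝔭 · x'`, the restrictions of `x'` to the other primes are those of `x`.
[cite: MochizukiFrdI2008, Def. 2.4(i) p.48] -/
theorem restrict_eq_of_eq_restrict_mul (hM : IsPerfFactorialWeak M) {𝔭 𝔮 : Primes (Perfection M)} {x x' : hM.Rlf}
    (hx : x = hM.restrict 𝔭 x * x') (hne : 𝔮 ≠ 𝔭) : hM.restrict 𝔮 x' = hM.restrict 𝔮 x := by
  apply restrict_eq_restrict_of_apply_eq
  have h1 := congrArg (fun z : hM.Rlf => (z : RlfFactor M) 𝔮) hx
  simp only [coe_mul, Pi.mul_apply, coe_restrict, single'_apply_of_ne hne, one_mul] at h1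
  exact h1.symm

/-! ### One prime at a time -/

/-- Two elements of `M^rlf` supported at the same single prime are comparable (`M^rlf_𝔭 ≅ ℝ_{≥0}` is totally
ordered). [cite: MochizukiFrdI2008, Def. 2.4(i) p.48] -/
theorem dvd_total_of_supp_subset_singleton (hM : IsPerfFactorialWeak M) {a b : hM.Rlf} {𝔭 : Primes (Perfection M)}
    (ha : supp (a : RlfFactor M) ⊆ {𝔭}) (hb : supp (b : RlfFactor M) ⊆ {𝔭}) : a ∣ b ∨ b ∣ a := by
  have htot := IsMonoprime.dvd_total (IsMonoprime.ofR (hM.isRMonoprime_rlfAt 𝔭))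
    ((a : RlfFactor M) 𝔭) ((b : RlfFactor M) 𝔭)
  have key : ∀ {c d : hM.Rlf}, supp (c : RlfFactor M) ⊆ {𝔭} →
      (c : RlfFactor M) 𝔭 ∣ (d : RlfFactor M) 𝔭 → c ∣ d := by
    intro c d hc hcd
    refine (dvd_iff hM c d).mpr fun 𝔮 => ?_
    by_cases h : 𝔮 = 𝔭
    · subst h
      exact hcd
    · have : (c : RlfFactor M) 𝔮 = 1 := by
        by_contra hne
        exact h (hc hne)
      rw [this]
      exact one_dvd _
  rcases htot with h | h
  · exact Or.inl (key ha h)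
  · exact Or.inr (key hb h)

/-- `Supp(ι p) = {𝔭}` for a primary `p ∈ 𝔭` of `M^pf`: a primary element of another class dividing `p`
would be `≼`-equivalent to it. [cite: MochizukiFrdI2008, Def. 2.4(i) p.47] -/
theorem supp_toRealification_of_mem_carrier (hM : IsPerfFactorialWeak M) {𝔭 : Primes (Perfection M)} {p : Perfection M}
    (hp : p ∈ 𝔭.carrier) : supp (hM.toRealification p : RlfFactor M) = {𝔭} := by
  refine Set.Subset.antisymm ?_ (Set.singleton_subset_iff.mpr (hM.mem_supp_factorMap_of_mem_carrier hp))
  intro 𝔮 h𝔮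
  rw [coe_toRealification] at h𝔮
  -- some primary `x ∈ 𝔮` divides `p`
  obtain ⟨x, hx, hxp⟩ : ∃ x ∈ 𝔮.carrier, x ∣ p := by
    by_contra hno
    exact h𝔮 (hM.factorMap_apply_eq_one fun y hy hyp => hno ⟨y, hy, hyp⟩)
  have hx𝔭 : x ∈ 𝔭.carrier := 𝔭.mem_carrier_of_precsim hp hx.1.1 (Precsim.of_dvd hxp)
  obtain ⟨h₁, rfl⟩ := hx
  obtain ⟨h₂, rfl⟩ := hx𝔭
  rfl

variable {f : M →* N}

/-- **`Supp(φ(x|_𝔭)) ⊆ Supp(ι_N f^pf p)`** for every primary `p ∈ 𝔭` and every `φ` over `f^pf`: `x|_𝔭 ≼ ι_M p` in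
`M^rlf` (archimedean comparison inside `M^rlf_𝔭`), homomorphisms preserve `≼`, and `≼` controls supports.
[cite: MochizukiFrdI2008, Prop. 5.3 p.103] -/
theorem supp_apply_restrict_subset (hM : IsPerfFactorialWeak M) (hN : IsPerfFactorialWeak N) (φ : hM.Rlf →* hN.Rlf)
    (hφ : ∀ a : Perfection M, φ (hM.toRealification a) = hN.toRealification (Perfection.map f a))
    (x : hM.Rlf) {𝔭 : Primes (Perfection M)} {p : Perfection M} (hp : p ∈ 𝔭.carrier) :
    supp (φ (hM.restrict 𝔭 x) : RlfFactor N) ⊆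
      supp (hN.toRealification (Perfection.map f p) : RlfFactor N) := by
  have h1 : hM.restrict 𝔭 x ≼ hM.toRealification p :=
    precsim_of_supp hM _ _ 𝔭 (hM.supp_restrict_subset 𝔭 x) (hM.mem_supp_factorMap_of_mem_carrier hp)
  have h2 : φ (hM.restrict 𝔭 x) ≼ φ (hM.toRealification p) := h1.map _
  rw [hφ] at h2
  exact supp_subset_of_precsim hN h2

/-- **`φ` kills no non-trivial element supported at one prime** (for `f` injective and `φ` over `f^pf`): such an
element dominates `ι_M p` for a primary `p ∈ 𝔭`, so `ι_N f^pf p ≼ φ d = 0` would force `f^pf p = 0`.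
[cite: MochizukiFrdI2008, Prop. 5.3 p.103] -/
theorem eq_one_of_apply_eq_one_of_supp_subset (hM : IsPerfFactorialWeak M) (hN : IsPerfFactorialWeak N) (φ : hM.Rlf →* hN.Rlf)
    (hφ : ∀ a : Perfection M, φ (hM.toRealification a) = hN.toRealification (Perfection.map f a))
    (hf : Injective f) {d : hM.Rlf} {𝔭 : Primes (Perfection M)} (hd : supp (d : RlfFactor M) ⊆ {𝔭})
    (h1 : φ d = 1) : d = 1 := by
  by_contra hne
  obtain ⟨𝔮, h𝔮⟩ := (ne_one_iff_supp_nonempty hM d).mp hne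
  have h𝔮𝔭 : 𝔮 = 𝔭 := hd h𝔮
  subst h𝔮𝔭
  obtain ⟨⟨p, hp'⟩, hp⟩ := Quotient.exists_rep 𝔮
  have hpc : p ∈ 𝔮.carrier := ⟨hp', hp⟩
  have h2 : hM.toRealification p ≼ d :=
    precsim_of_supp hM _ _ 𝔮 (supp_toRealification_of_mem_carrier hM hpc).le h𝔮
  have h3 : hN.toRealification (Perfection.map f p) ≼ 1 := by
    have := h2.map φ
    rwa [hφ, h1] at this
  obtain ⟨n, -, hn⟩ := h3
  rw [one_pow] at hn
  have h4 : hN.toRealification (Perfection.map f p) = 1 := (isSharp hN).1 _ (isUnit_of_dvd_one hn)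
  have h5 : Perfection.map f p = 1 := by
    apply hN.factorMap_injective
    have := congrArg Subtype.val h4
    rw [coe_toRealification, coe_one] at this
    rw [this, hN.factorMap_one]
  have h6 : p = 1 := Perfection.map_injective f hf (by rw [h5, map_one])
  exact hp'.1 h6

/-- `φ(x|_𝔭) = φ(y|_𝔭)` forces `x|_𝔭 = y|_𝔭` (one prime is totally ordered; `φ` kills no single-prime element).
[cite: MochizukiFrdI2008, Prop. 5.3 p.103] -/
theorem restrict_eq_of_apply_restrict_eq (hM : IsPerfFactorialWeak M) (hN : IsPerfFactorialWeak N) (φ : hM.Rlf →* hN.Rlf)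
    (hφ : ∀ a : Perfection M, φ (hM.toRealification a) = hN.toRealification (Perfection.map f a))
    (hf : Injective f) {x y : hM.Rlf} {𝔭 : Primes (Perfection M)}
    (h : φ (hM.restrict 𝔭 x) = φ (hM.restrict 𝔭 y)) : hM.restrict 𝔭 x = hM.restrict 𝔭 y := by
  haveI := isCancelMul hN
  have key : ∀ {a b : hM.Rlf}, supp (b : RlfFactor M) ⊆ {𝔭} → a ∣ b → φ a = φ b → a = b := by
    intro a b hb hab he
    obtain ⟨d, rfl⟩ := hab
    have hd : supp (d : RlfFactor M) ⊆ {𝔭} := by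
      refine Set.Subset.trans ?_ hb
      rw [coe_mul, mul_comm]
      exact supp_subset_supp_mul _ _
    rw [map_mul] at he
    have hd1 : φ d = 1 := mul_left_cancel (a := φ a) (by rw [mul_one]; exact he.symm)
    rw [eq_one_of_apply_eq_one_of_supp_subset hM hN φ hφ hf hd hd1, mul_one]
  rcases dvd_total_of_supp_subset_singleton hM (hM.supp_restrict_subset 𝔭 x)
      (hM.supp_restrict_subset 𝔭 y) with hxy | hyx
  · exact key (hM.supp_restrict_subset 𝔭 y) hxy h
  · exact (key (hM.supp_restrict_subset 𝔭 x) hyx h.symm).symm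


end Rlf

end IsPerfFactorialWeak

end Literature.AlgebraicGeometry.Frobenioids

end
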